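import Literature.RingTheory.MvPolynomial.FormsLinearSubspaces
import HarnessLib

/-!
# Chains of two lines through two zeros of a system of forms (`Σ d_a² ≤ N`)

Tian–Zong, *One-cycles on rationally connected varieties*, Compositio Math. 150 (2014) =
arXiv:1209.4342 [TianZong2014], proof of Prop. 7.2 (p. 10 of the arXiv text): for
`X = V(F_1, …, F_c) ⊆ ℙⁿ` defined by forms of degrees `d_1, …, d_c` with `Σ d_i² ≤ n`, "`X` is
rationally chain connected by chains of two lines. And furthermore, the scheme parameterizing the
chain of two lines containing two points is defined by equations of degree
`(1, 2, …, d_1 - 1, 1, 2, …, d_1 - 1, d_1, …, 1, 2, …, d_c - 1, 1, 2, …, d_c - 1, d_c)`. To see this,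
just consider the equations for the intersection point of the two lines. … Then by Tsen's theorem,
there is a `K(C)`-rational point in the scheme."

This file proves the algebra of that sentence over an arbitrary field `K`
(`exists_two_line_chain`): if `p, q ∈ Kᴺ⁺¹` are common zeros of forms `F_a` of degrees
`d_a ≥ 1` with `Σ_a d_a² < N + 1`, and `K` has the property that every finite system of forms of
positive degrees `e_j` in `N + 1` variables with `Σ e_j < N + 1` has a common non-trivial zero
(Tsen–Lang for function fields of curves; the hypothesis `hK`), then there is `r ≠ 0` in `Kᴺ⁺¹`
with `F_a(s p + t r) = F_a(s q + t r) = 0` for all `s, t ∈ K` and all `a` — the two lines `p r`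
and `r q` lie on `X`. The unknown is the middle point `r`; the equations are the coefficients of
`s^e`, `1 ≤ e ≤ d_a - 1`, of `F_a(s p + r)` and of `F_a(s q + r)` (forms of degrees `d_a - e` in
`r`, by the bihomogeneous bookkeeping `Literature.RingTheory.MvPolynomial.isBihom_aeval`), together
with `F_a(r)` itself: degrees `1, …, d_a - 1` twice and `d_a`, of sum `d_a²` (`two_mul_sum_fin_add`).
The verification `F_a(s p + t r) = s^{d_a} F_a(p) = 0` is
`eval_eval_smul_eq_of_isBihom_of_degree` (`FormsLinearSubspaces.lean`).

The hypothesis `hK` is discharged, for fields of transcendence degree one over an algebraically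
closed field, by the systems form of Tsen's theorem
(`Literature.FieldTheory.QuasiAlgClosed.exists_common_zero_of_trdeg_eq_one`, file
`FieldTheory/QuasiAlgClosed/TsenSystems.lean`); it is kept abstract here so that this file only
depends on the polynomial algebra.

## References

* [TianZong2014] Z. Tian, H. R. Zong, *One-cycles on rationally connected varieties*, Compositio
  Math. 150 (2014) 396–408, proof of Prop. 7.2.
-/

noncomputable section

open _root_.MvPolynomial

namespace Literature.RingTheory.MvPolynomial

universe u

variable {K : Type u} [Field K] {N : ℕ}

/-! ### The substitution `F(s • p + y)` through one point -/

/-- The substituted form `F(s p + y) ∈ (K[y])[s]` (one `s`-variable; the case `u = 1`,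
`w₀ = p` of the greedy construction of `CubicFormLinearSubspaces.lean`). [folklore] -/
abbrev linePoly (p : Fin (N + 1) → K) (F : MvPolynomial (Fin (N + 1)) K) :
    MvPolynomial (Fin 1) (MvPolynomial (Fin (N + 1)) K) :=
  aeval (fun m : Fin (N + 1) =>
    (∑ j : Fin 1, C (C ((fun _ : Fin 1 => p) j m)) * X j) + C (X m) :
      Fin (N + 1) → MvPolynomial (Fin 1) (MvPolynomial (Fin (N + 1)) K)) F

/-- `F(s p + y)` is bihomogeneous of degree `d` when `F` is a form of degree `d`: its coefficient
at `s^e` is a form of degree `d - e` in `y`, zero for `e > d`. [folklore] -/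
theorem isBihom_linePoly (p : Fin (N + 1) → K) {F : MvPolynomial (Fin (N + 1)) K} {d : ℕ}
    (hF : F.IsHomogeneous d) :
    ∀ α, (coeff α (linePoly p F)).IsHomogeneous (d - α.degree) ∧
      (d < α.degree → coeff α (linePoly p F) = 0) := by
  refine isBihom_aeval hF _ fun m => ?_
  refine isBihom_add (isBihom_sum _ _ fun j _ => ?_)
    (isBihom_C_of_isHomogeneous_one (isHomogeneous_X K m))
  simpa using isBihom_mul (isBihom_C_C (σ := Fin 1) (τ := Fin (N + 1)) (p m))
    (isBihom_X (k := K) (τ := Fin (N + 1)) j)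

/-- Two-level evaluation: `F(s p + y)(s := c)(y := v) = F(c • p + v)`. [folklore] -/
theorem eval_eval_linePoly (p : Fin (N + 1) → K) (F : MvPolynomial (Fin (N + 1)) K) (c : K)
    (v : Fin (N + 1) → K) :
    eval v (eval (fun _ => C c) (linePoly p F)) = eval (c • p + v) F := by
  have h := eval_eval_aeval_lin (fun _ : Fin 1 => p) F (fun _ => c) v
  have hfun : (fun m => ∑ _j : Fin 1, c * p m + v m) = c • p + v := by
    funext m
    simp [Pi.add_apply, Pi.smul_apply, smul_eq_mul]
  rw [hfun] at h
  exact h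

/-- The coefficient of `s⁰` of `F(s p + y)`, evaluated at `v`, is `F(v)`. [folklore] -/
theorem eval_coeff_zero_linePoly (p : Fin (N + 1) → K) (F : MvPolynomial (Fin (N + 1)) K)
    (v : Fin (N + 1) → K) : eval v (coeff 0 (linePoly p F)) = eval v F := by
  classical
  have h := eval_eval_linePoly p F 0 v
  rw [zero_smul, zero_add] at h
  rw [← h, show (fun _ : Fin 1 => C (0 : K)) = fun j : Fin 1 => C ((fun _ : Fin 1 => (0 : K)) j)
    from rfl, eval_eval_eq_sum]
  rw [Finset.sum_eq_single (0 : Fin 1 →₀ ℕ)]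
  · simp
  · intro α _ hα
    have h0 : α 0 ≠ 0 := by
      intro h0
      apply hα
      refine Finsupp.ext fun j => ?_
      rw [Subsingleton.elim j 0, h0, Finsupp.coe_zero, Pi.zero_apply]
    rw [Fin.prod_univ_one, zero_pow h0, zero_mul]
  · intro hnot
    rw [notMem_support_iff.1 hnot, map_zero, mul_zero]

/-- A finitely supported function on `Fin 1` is the single of its degree. [folklore] -/
theorem finsupp_fin_one_eq_single (α : Fin 1 →₀ ℕ) : α = Finsupp.single 0 α.degree := by
  refine Finsupp.ext fun j => ?_
  rw [Subsingleton.elim j 0, Finsupp.single_eq_same, Finsupp.degree_eq_sum, Fin.sum_univ_one]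

/-! ### Counting the degrees: `2 (1 + 2 + ⋯ + (d-1)) + d = d²` -/

/-- `Σ_{e < n} (n - e) ` doubled is `n (n + 1)`. [folklore] -/
theorem two_mul_sum_fin_sub (n : ℕ) : 2 * ∑ e : Fin n, (n - (e : ℕ)) = n * (n + 1) := by
  induction n with
  | zero => simp
  | succ n ih =>
    rw [Fin.sum_univ_succ]
    simp only [Fin.val_zero, tsub_zero, Fin.val_succ, Nat.succ_sub_succ_eq_sub]
    rw [mul_add, ih]
    ring

/-- The degree count of the two-line-chain system for one form of degree `d ≥ 1`: the coefficients
of `s^e`, `1 ≤ e ≤ d - 1`, through each of the two points (degrees `d - e`), and `F` itself: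
`2 Σ_{e < d-1} (d - 1 - e) + d = d²`. [cite: TianZong2014, proof of Prop. 7.2] -/
theorem two_mul_sum_fin_add {d : ℕ} (hd : 0 < d) :
    2 * ∑ e : Fin (d - 1), (d - 1 - (e : ℕ)) + d = d ^ 2 := by
  rw [two_mul_sum_fin_sub (d - 1)]
  obtain ⟨d, rfl⟩ := Nat.exists_eq_add_one_of_ne_zero hd.ne'
  simp only [Nat.add_sub_cancel]
  ring

/-! ### The two-line chain -/

/-- **Chains of two lines through two points** (the algebra of Tian–Zong's proof of Prop. 7.2).
Let `F_a`, `a : Fin c`, be forms of degrees `d_a ≥ 1` in `N + 1` variables over a field `K` such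
that every finite system of forms of positive degrees `e_j` in `N + 1` variables over `K` with
`Σ e_j < N + 1` has a common non-trivial zero (`hK`; e.g. `K` of transcendence degree one over an
algebraically closed field, by Tsen–Lang). If `Σ_a d_a² < N + 1` then for any two common zeros
`p, q` of the `F_a` there is `r ≠ 0` such that all `F_a` vanish identically on the lines `p r` and
`q r`: `F_a(s p + t r) = F_a(s q + t r) = 0` for all `s, t`. The unknown is `r`; the equations are
the `s^e`-coefficients (`1 ≤ e ≤ d_a - 1`) of `F_a(s p + r)` and `F_a(s q + r)` and `F_a(r)`, of
degrees "`(1, 2, …, d_a - 1, 1, 2, …, d_a - 1, d_a)`", with degree sum `Σ_a d_a²`.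
[cite: TianZong2014, proof of Prop. 7.2] -/
theorem exists_two_line_chain
    (hK : ∀ {ι : Type} [Fintype ι] (g : ι → MvPolynomial (Fin (N + 1)) K) (e : ι → ℕ),
      (∀ j, 0 < e j) → (∀ j, (g j).IsHomogeneous (e j)) → ∑ j, e j < N + 1 →
      ∃ x : Fin (N + 1) → K, x ≠ 0 ∧ ∀ j, eval x (g j) = 0)
    {c : ℕ} {F : Fin c → MvPolynomial (Fin (N + 1)) K} {d : Fin c → ℕ}
    (hF : ∀ a, (F a).IsHomogeneous (d a)) (hd : ∀ a, 0 < d a) (hN : ∑ a, d a ^ 2 < N + 1)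
    {p q : Fin (N + 1) → K} (hp : ∀ a, eval p (F a) = 0) (hq : ∀ a, eval q (F a) = 0) :
    ∃ r : Fin (N + 1) → K, r ≠ 0 ∧ ∀ a (s t : K),
      eval (s • p + t • r) (F a) = 0 ∧ eval (s • q + t • r) (F a) = 0 := by
  classical
  -- the system: `s^{e+1}`-coefficients through `p` and through `q`, `e < d_a - 1`, and `F_a`
  let J : Type := ((Σ a : Fin c, Fin (d a - 1)) ⊕ (Σ a : Fin c, Fin (d a - 1))) ⊕ Fin c
  let g : J → MvPolynomial (Fin (N + 1)) K :=
    Sum.elim (Sum.elim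
      (fun x => coeff (Finsupp.single 0 ((x.2 : ℕ) + 1)) (linePoly p (F x.1)))
      (fun x => coeff (Finsupp.single 0 ((x.2 : ℕ) + 1)) (linePoly q (F x.1))))
      (fun a => F a)
  let e : J → ℕ :=
    Sum.elim (Sum.elim (fun x => d x.1 - 1 - (x.2 : ℕ)) (fun x => d x.1 - 1 - (x.2 : ℕ)))
      (fun a => d a)
  have he : ∀ j, 0 < e j := by
    rintro ((⟨a, i⟩ | ⟨a, i⟩) | a)
    · change 0 < d a - 1 - (i : ℕ); have := i.2; omega
    · change 0 < d a - 1 - (i : ℕ); have := i.2; omega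
    · exact hd a
  have hg : ∀ j, (g j).IsHomogeneous (e j) := by
    rintro ((⟨a, i⟩ | ⟨a, i⟩) | a)
    · have h := (isBihom_linePoly p (hF a) (Finsupp.single 0 ((i : ℕ) + 1))).1
      rw [Finsupp.degree_single] at h
      change (coeff (Finsupp.single 0 ((i : ℕ) + 1)) (linePoly p (F a))).IsHomogeneous
        (d a - 1 - (i : ℕ))
      convert h using 1
      omega
    · have h := (isBihom_linePoly q (hF a) (Finsupp.single 0 ((i : ℕ) + 1))).1
      rw [Finsupp.degree_single] at h
      change (coeff (Finsupp.single 0 ((i : ℕ) + 1)) (linePoly q (F a))).IsHomogeneous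
        (d a - 1 - (i : ℕ))
      convert h using 1
      omega
    · exact hF a
  have hcount : ∑ j, e j < N + 1 := by
    refine lt_of_le_of_lt (le_of_eq ?_) hN
    rw [Fintype.sum_sum_type, Fintype.sum_sum_type, Fintype.sum_sigma, Fintype.sum_sigma,
      ← Finset.sum_add_distrib, ← Finset.sum_add_distrib]
    refine Finset.sum_congr rfl fun a _ => ?_
    change ∑ i : Fin (d a - 1), (d a - 1 - (i : ℕ)) + ∑ i : Fin (d a - 1), (d a - 1 - (i : ℕ)) + d a
      = d a ^ 2
    rw [← two_mul, two_mul_sum_fin_add (hd a)]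
  obtain ⟨r, hr0, hr⟩ := hK g e he hg hcount
  -- verification
  have hzero : ∀ (w : Fin (N + 1) → K) (hw : ∀ a, eval w (F a) = 0)
      (hcoef : ∀ a (i : Fin (d a - 1)),
        eval r (coeff (Finsupp.single 0 ((i : ℕ) + 1)) (linePoly w (F a))) = 0)
      (a : Fin c) (s t : K), eval (s • w + t • r) (F a) = 0 := by
    intro w hw hcoef a s t
    have hv : ∀ α ∈ (linePoly w (F a)).support, α.degree < d a →
        eval r (coeff α (linePoly w (F a))) = 0 := by
      intro α _ hα
      rw [finsupp_fin_one_eq_single α]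
      rcases Nat.eq_zero_or_pos α.degree with h0 | hpos
      · rw [h0, Finsupp.single_zero, eval_coeff_zero_linePoly]
        exact hr (Sum.inr a)
      · obtain ⟨m, hm⟩ := Nat.exists_eq_succ_of_ne_zero hpos.ne'
        have hlt : m < d a - 1 := by omega
        rw [hm]
        exact hcoef a ⟨m, hlt⟩
    have key := eval_eval_smul_eq_of_isBihom_of_degree (isBihom_linePoly w (hF a)) hv
      (fun _ => s) t
    rw [eval_eval_linePoly, eval_eval_linePoly, add_zero, eval_smul_of_isHomogeneous (hF a), hw a,
      mul_zero] at key
    exact key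
  refine ⟨r, hr0, fun a s t => ⟨hzero p hp (fun a i => hr (Sum.inl (Sum.inl ⟨a, i⟩))) a s t,
    hzero q hq (fun a i => hr (Sum.inl (Sum.inr ⟨a, i⟩))) a s t⟩⟩

end Literature.RingTheory.MvPolynomial

end
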